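import Summits.Ventures.LatticeQCDFlow.Scaling.DominatedStarAugmentation

/-!
HONEST FRAMING: exact (Metropolis-corrected) sampling algorithms for lattice gauge theory; figures
of merit are autocorrelation/cost numbers at stated couplings and volumes; no continuum-physics
claim.

# DoeblinHotAugmentation — THE MAP-ASSISTED HUB WHOSE HOT LEVEL IS REFRESHED ONLY PART OF THE TIME: THE AUGMENTED
# CHAIN `(configuration, stale set)` WHEN THE HOT STEP IS AN EXACT REFRESH WITH WEIGHT `w_E` (ERASING THE HUB TAG) PLUS
# `μ_k`-STATIONARY SINGLE-SITE MOVES WITH WEIGHTS `w_k` AT EVERY LEVEL, THE HUB INCLUDED (TAGS UNCHANGED) — IT IS A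
# TRANSITION MATRIX LUMPING ONTO THE SCHEME `t·GSw + (1−t)·(w_E·Ẽ_0 + Π_w^M)`, AND ITS ONE-STEP ACTION ON LAWS IS
# EXPLICIT (lean-2 GEN-27, ours)

Venture-side (OURS).  Cell `lqcd-flow` (pub-lqcd), unit `pub-lqcd-lean-2-g27`, 2026-08-27.  Chapter M continued —
DOEBLIN-MINORISED HOT SAMPLERS, file 1.  Chapter M (`Scaling/DominatedStarAugmentation` … `Scaling/DominatedStarMixingCeiling`)
assumed the EXACT hot sampler `M_0(u,·) = μ_0`: every hot update regenerates the hub.  A realistic hot level — an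
independence sampler driven by a normalizing flow, Metropolis-corrected — is only `μ_0`-STATIONARY with a DOEBLIN
MINORISATION `M_0(u,·) ≥ a·μ_0(·)` (importance weights bounded by `1/a`); such a kernel splits as
`M_0 = a·Ẽ + (1−a)·R` with `Ẽ(u,·) = μ_0` and `R` `μ_0`-stationary (the sequel `Scaling/DoeblinHotSampler`).  This file
re-runs the augmentation of chapter M for the general hot step: with probability `(1−t)·w_E` the hub is REFRESHED
exactly (tag `0` erased), with probability `(1−t)·w_k` level `k` — THE HUB `k = 0` INCLUDED — makes a `μ_k`-stationary
single-site move `M_k` (tags unchanged); `w_E + Σ_k w_k = 1`.  The swap part (entries `r`, cold level `l = κ_r+1`,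
proposal `y_r`, acceptance `α_r`, good tag `σ_r(D)` with weight `γ_r`, bad tag `B_r(D)`) is chapter M's VERBATIM
(`Scaling/DominatedStarEntrySwap`, `Scaling/DominatedStarAugmentation`).  `E` denotes the family of exact samplers
`E_k(u,v) = μ_k(v)` (only `E_0` is used).  Everything is carried as hypothesis-equations (no definitions).

## What is proved

* §1 **`dob_aug_isRowStochastic`**; **`dob_lump_fst`** (the configuration marginal of `P̂` is the scheme
  `t·GSw + (1−t)·(w_E·Ẽ_0 + Π_w^M)`, `Ẽ_0 = coordKernel E 0`); **`dob_lawAt_fst_of`** (from any initial augmented law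
  `Λ₀` the configuration marginal at time `n` is `λ₀Pⁿ`, `λ₀ = Σ_D Λ₀(·, D)`); `dob_scheme_isRowStochastic`.
* §2 **`dob_stepLaw_apply`** — THE ONE-STEP ACTION ON A LAW, by entry and SOURCE tag:
  `(λP̂)(z',D') = Σ_r (t/m) Σ_D [𝟙{D' = σ_r D}·λ(y,D)γ_r(y,D) + 𝟙{D' = B_r D}·(λ(y,D)(α_r(y) − γ_r(y,D)) + λ(z',D)(1 − α_r(z')))]`
  `+ (1−t)·(w_E·Σ_{D : D ∖ {0} = D'} Σ_u λ(z'[0 ↦ u], D)·E_0(u, z'_0) + Σ_k w_k Σ_u λ(z'[k ↦ u], D')·M_k(u, z'_k))`.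

Reading (no numerics implied): bookkeeping for `Scaling/DoeblinHotFreshness`; chapter M is the case `w_0 = 0` of the
present weights with `w_E` its hot weight, `Scaling/DominatedStarLazyHotSampler` the case `M_0 = Id`.  NOT CLAIMED here:
anything quantitative.  Literature grade (cell rule): OWN CONSTRUCTION; nothing cited as a fact; no new bib keys.
-/

noncomputable section

open Finset Function
open Literature.Probability.MarkovChains

namespace Summit.Ventures.LatticeQCDFlow.Scaling

variable {S : Type*} [Fintype S] [DecidableEq S] {K m : ℕ} {μ : Fin (K + 1) → S → ℝ} {M E : Fin (K + 1) → S → S → ℝ}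
  {w : Fin (K + 1) → ℝ} {t wE p q : ℝ}

section Aug
variable (κ : Fin m → Fin K) (φ : Fin m → Equiv.Perm S)

/-! ## §1 The augmented chain: a transition matrix lumping onto the scheme -/

/-- Row sums of a tagged coordinate move: `Σ_b coordKernel M k (y, b.1)·𝟙{b.2 = T} = 1` (`M_k` row-stochastic). [ours] -/
theorem sum_coordKernel_tag_eq_one {N : Fin (K + 1) → S → S → ℝ} (k : Fin (K + 1)) (hN : IsRowStochastic (N k))
    (y : Fin (K + 1) → S) (T : Finset (Fin (K + 1))) :
    ∑ b : (Fin (K + 1) → S) × Finset (Fin (K + 1)), coordKernel N k y b.1 * (if b.2 = T then (1 : ℝ) else 0) = 1 := by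
  rw [Fintype.sum_prod_type]
  simp_rw [← Finset.mul_sum, Finset.sum_ite_eq' univ, if_pos (mem_univ _), mul_one]
  have h := sum_coordKernel_mul N k y (fun _ => (1 : ℝ))
  simp only [mul_one] at h
  rw [h, hN.2]

omit [DecidableEq S] in
/-- The exact samplers `E_k(u, v) = μ_k(v)` are transition matrices (`μ_k` positive of unit mass). [ours] -/
theorem exactSampler_isRowStochastic (hμ : ∀ k x, 0 < μ k x) (hμ1 : ∀ k, ∑ u, μ k u = 1) (hE : ∀ k u v, E k u v = μ k v)
    (k : Fin (K + 1)) : IsRowStochastic (E k) :=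
  ⟨fun u v => by rw [hE]; exact (hμ k v).le, fun u => by simp_rw [hE]; exact hμ1 k⟩

/-- **The augmented chain is a transition matrix** (`0 ≤ t ≤ 1`, `m ≥ 1`, `w_E ≥ 0`, `w ≥ 0`, `w_E + Σ_k w_k = 1`,
`M_k` row-stochastic, `μ_k` positive of unit mass, `0 ≤ γ_r ≤ α_r`). [ours] -/
theorem dob_aug_isRowStochastic (hm : 1 ≤ m) (ht0 : 0 ≤ t) (ht1 : t ≤ 1) (hwE0 : 0 ≤ wE) (hw0 : ∀ k, 0 ≤ w k)
    (hw1 : wE + ∑ k, w k = 1) (hM : ∀ k, IsRowStochastic (M k)) (hμ : ∀ k x, 0 < μ k x) (hμ1 : ∀ k, ∑ u, μ k u = 1)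
    (hE : ∀ k u v, E k u v = μ k v)
    {α : Fin m → (Fin (K + 1) → S) → ℝ}
    (hα : ∀ r z, α r z = min 1 (tensorFun μ (edgeFlowSwap (φ r) 0 (κ r).succ z) / tensorFun μ z))
    {γ : Fin m → (Fin (K + 1) → S) × Finset (Fin (K + 1)) → ℝ} (hγα : ∀ r a, 0 ≤ γ r a ∧ γ r a ≤ α r a.1)
    {Bset : Fin m → Finset (Fin (K + 1)) → Finset (Fin (K + 1))}
    {Ph : (Fin (K + 1) → S) × Finset (Fin (K + 1)) → (Fin (K + 1) → S) × Finset (Fin (K + 1)) → ℝ}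
    (hPh : ∀ a b, Ph a b = ∑ r : Fin m, t / m *
        (γ r a * (if b.1 = edgeFlowSwap (φ r) 0 (κ r).succ a.1 ∧ b.2 = a.2.image (Equiv.swap (0 : Fin (K + 1)) (κ r).succ)
            then (1 : ℝ) else 0)
          + (α r a.1 - γ r a) * (if b.1 = edgeFlowSwap (φ r) 0 (κ r).succ a.1 ∧ b.2 = Bset r a.2 then (1 : ℝ) else 0)
          + (1 - α r a.1) * (if b.1 = a.1 ∧ b.2 = Bset r a.2 then (1 : ℝ) else 0))
      + (1 - t) * (wE * (coordKernel E 0 a.1 b.1 * (if b.2 = a.2.erase 0 then (1 : ℝ) else 0))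
          + ∑ k : Fin (K + 1), w k * (coordKernel M k a.1 b.1 * (if b.2 = a.2 then (1 : ℝ) else 0)))) :
    IsRowStochastic Ph := by
  have hmpos : (0 : ℝ) < m := Nat.cast_pos.mpr (by omega)
  have hErs := exactSampler_isRowStochastic hμ hμ1 hE
  refine ⟨fun a b => ?_, fun a => ?_⟩
  · rw [hPh]
    have hg := hγα
    refine add_nonneg (sum_nonneg fun r _ => mul_nonneg (by positivity) (add_nonneg (add_nonneg ?_ ?_) ?_))
      (mul_nonneg (by linarith) (add_nonneg (mul_nonneg hwE0 (mul_nonneg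
        (coordKernel_nonneg E (fun j u v => (hErs j).1 u v) 0 _ _) (by split_ifs <;> norm_num)))
        (sum_nonneg fun k _ => mul_nonneg (hw0 k) (mul_nonneg
        (coordKernel_nonneg M (fun j u v => (hM j).1 u v) k _ _) (by split_ifs <;> norm_num)))))
    · exact mul_nonneg (hg r a).1 (by split_ifs <;> norm_num)
    · exact mul_nonneg (by linarith [(hg r a).2]) (by split_ifs <;> norm_num)
    · exact mul_nonneg (by linarith [(accept_mem κ φ hμ hα r a.1).2]) (by split_ifs <;> norm_num)
  · have hswap : ∀ r : Fin m, ∑ b : (Fin (K + 1) → S) × Finset (Fin (K + 1)),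
        (γ r a * (if b.1 = edgeFlowSwap (φ r) 0 (κ r).succ a.1 ∧ b.2 = a.2.image (Equiv.swap (0 : Fin (K + 1)) (κ r).succ)
            then (1 : ℝ) else 0)
          + (α r a.1 - γ r a) * (if b.1 = edgeFlowSwap (φ r) 0 (κ r).succ a.1 ∧ b.2 = Bset r a.2 then (1 : ℝ) else 0)
          + (1 - α r a.1) * (if b.1 = a.1 ∧ b.2 = Bset r a.2 then (1 : ℝ) else 0)) = 1 := by
      intro r
      rw [Finset.sum_add_distrib, Finset.sum_add_distrib, ← Finset.mul_sum, ← Finset.mul_sum, ← Finset.mul_sum,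
        sum_ite_pairEq_one, sum_ite_pairEq_one, sum_ite_pairEq_one]
      ring
    have hupdE := sum_coordKernel_tag_eq_one (0 : Fin (K + 1)) (hErs 0) a.1 (a.2.erase 0)
    have hupd : ∀ k : Fin (K + 1), ∑ b : (Fin (K + 1) → S) × Finset (Fin (K + 1)),
        coordKernel M k a.1 b.1 * (if b.2 = a.2 then (1 : ℝ) else 0) = 1 :=
      fun k => sum_coordKernel_tag_eq_one k (hM k) a.1 a.2
    have hsplit : ∑ b, Ph a b = ∑ r : Fin m, t / m * 1 + (1 - t) * (wE * 1 + ∑ k : Fin (K + 1), w k * 1) := by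
      simp_rw [hPh]
      rw [Finset.sum_add_distrib, Finset.sum_comm, ← Finset.mul_sum]
      congr 1
      · refine sum_congr rfl fun r _ => ?_
        rw [← Finset.mul_sum, hswap r]
      · congr 1
        rw [Finset.sum_add_distrib, ← Finset.mul_sum, hupdE]
        congr 1
        rw [Finset.sum_comm]
        refine sum_congr rfl fun k _ => ?_
        rw [← Finset.mul_sum, hupd k]
    rw [hsplit]
    simp_rw [mul_one, sum_const, card_univ, Fintype.card_fin, nsmul_eq_mul]
    rw [hw1]
    field_simp
    ring

/-- **The scheme `t·GSw + (1−t)·(w_E·Ẽ_0 + Π_w^M)` is a transition matrix.** [ours] -/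
theorem dob_scheme_isRowStochastic (ht0 : 0 ≤ t) (ht1 : t ≤ 1) (hwE0 : 0 ≤ wE) (hw0 : ∀ k, 0 ≤ w k)
    (hw1 : wE + ∑ k, w k = 1) (hM : ∀ k, IsRowStochastic (M k)) (hμ : ∀ k x, 0 < μ k x) (hμ1 : ∀ k, ∑ u, μ k u = 1)
    (hE : ∀ k u v, E k u v = μ k v) :
    IsRowStochastic (fun y z : Fin (K + 1) → S =>
      t * ptGraphSwap μ (fun r : Fin m => (((0 : Fin (K + 1)), (κ r).succ) : Fin (K + 1) × Fin (K + 1))) φ y z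
        + (1 - t) * (wE * coordKernel E 0 y z + prodKernel w M y z)) := by
  have hErs := exactSampler_isRowStochastic hμ hμ1 hE
  have hG := ptGraphSwap_isRowStochastic
    (e := fun r : Fin m => (((0 : Fin (K + 1)), (κ r).succ) : Fin (K + 1) × Fin (K + 1))) (φ := φ) hμ
  have hUnn : ∀ y z : Fin (K + 1) → S, 0 ≤ prodKernel w M y z := fun y z => by
    rw [prodKernel_apply]
    exact sum_nonneg fun k _ => mul_nonneg (hw0 k) (coordKernel_nonneg M (fun j u v => (hM j).1 u v) k _ _)
  refine ⟨fun y z => add_nonneg (mul_nonneg ht0 (hG.1 y z)) (mul_nonneg (by linarith) (add_nonneg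
      (mul_nonneg hwE0 (coordKernel_nonneg E (fun j u v => (hErs j).1 u v) 0 _ _)) (hUnn y z))), fun y => ?_⟩
  have hE1 : ∑ z, coordKernel E 0 y z = 1 := by
    have h := sum_coordKernel_mul E 0 y (fun _ => (1 : ℝ))
    simp only [mul_one] at h
    rw [h, (hErs 0).2]
  have hM1 : ∀ k, ∑ z, coordKernel M k y z = 1 := fun k => by
    have h := sum_coordKernel_mul M k y (fun _ => (1 : ℝ))
    simp only [mul_one] at h
    rw [h, (hM k).2]
  have hU : ∑ z, prodKernel w M y z = ∑ k, w k := by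
    simp_rw [prodKernel_apply]
    rw [Finset.sum_comm]
    exact sum_congr rfl fun k _ => by rw [← Finset.mul_sum, hM1 k, mul_one]
  simp only
  rw [Finset.sum_add_distrib, ← Finset.mul_sum, ← Finset.mul_sum, hG.2 y, Finset.sum_add_distrib, ← Finset.mul_sum,
    hE1, hU]
  linear_combination (1 - t) * hw1

/-- **FIRST LUMPING: the configuration marginal of `P̂` is the scheme `t·GSw + (1−t)·(w_E·Ẽ_0 + Π_w^M)`** (`m ≥ 1`,
`μ > 0`). [ours] -/
theorem dob_lump_fst (hm : 1 ≤ m) (hμ : ∀ k x, 0 < μ k x)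
    {α : Fin m → (Fin (K + 1) → S) → ℝ}
    (hα : ∀ r z, α r z = min 1 (tensorFun μ (edgeFlowSwap (φ r) 0 (κ r).succ z) / tensorFun μ z))
    {γ : Fin m → (Fin (K + 1) → S) × Finset (Fin (K + 1)) → ℝ}
    {Bset : Fin m → Finset (Fin (K + 1)) → Finset (Fin (K + 1))}
    {Ph : (Fin (K + 1) → S) × Finset (Fin (K + 1)) → (Fin (K + 1) → S) × Finset (Fin (K + 1)) → ℝ}
    (hPh : ∀ a b, Ph a b = ∑ r : Fin m, t / m *
        (γ r a * (if b.1 = edgeFlowSwap (φ r) 0 (κ r).succ a.1 ∧ b.2 = a.2.image (Equiv.swap (0 : Fin (K + 1)) (κ r).succ)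
            then (1 : ℝ) else 0)
          + (α r a.1 - γ r a) * (if b.1 = edgeFlowSwap (φ r) 0 (κ r).succ a.1 ∧ b.2 = Bset r a.2 then (1 : ℝ) else 0)
          + (1 - α r a.1) * (if b.1 = a.1 ∧ b.2 = Bset r a.2 then (1 : ℝ) else 0))
      + (1 - t) * (wE * (coordKernel E 0 a.1 b.1 * (if b.2 = a.2.erase 0 then (1 : ℝ) else 0))
          + ∑ k : Fin (K + 1), w k * (coordKernel M k a.1 b.1 * (if b.2 = a.2 then (1 : ℝ) else 0))))
    (a : (Fin (K + 1) → S) × Finset (Fin (K + 1))) (z' : Fin (K + 1) → S) :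
    t * ptGraphSwap μ (fun r : Fin m => (((0 : Fin (K + 1)), (κ r).succ) : Fin (K + 1) × Fin (K + 1))) φ a.1 z'
        + (1 - t) * (wE * coordKernel E 0 a.1 z' + prodKernel w M a.1 z')
      = ∑ b ∈ univ.filter (fun b : (Fin (K + 1) → S) × Finset (Fin (K + 1)) => b.1 = z'), Ph a b := by
  have he := hubList_fst_ne_snd (K := K) κ
  rw [sum_filter_prodFst_eq, ptGraphSwap_eq_avg_entryKernel hm he hμ, prodKernel_apply]
  simp_rw [hPh, Finset.sum_add_distrib]
  congr 1
  · rw [Finset.mul_sum, Finset.sum_comm]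
    refine sum_congr rfl fun r _ => ?_
    rw [← Finset.mul_sum, Finset.sum_add_distrib, Finset.sum_add_distrib, ← Finset.mul_sum, ← Finset.mul_sum,
      ← Finset.mul_sum, sum_ite_eqAnd_tag, sum_ite_eqAnd_tag, sum_ite_eqAnd_tag,
      entrySwap_eq_accept_reject κ φ hμ hα r a.1 z']
    ring
  · rw [← Finset.mul_sum]
    congr 1
    rw [Finset.sum_add_distrib, ← Finset.mul_sum, ← Finset.mul_sum, Finset.sum_ite_eq' univ, if_pos (mem_univ _), mul_one]
    congr 1
    rw [Finset.sum_comm]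
    refine sum_congr rfl fun k _ => ?_
    rw [← Finset.mul_sum, ← Finset.mul_sum, Finset.sum_ite_eq' univ, if_pos (mem_univ _), mul_one]

/-- **THE CONFIGURATION MARGINAL FROM ANY INITIAL AUGMENTED LAW: `Σ_D Λ_n(z, D) = (λ₀Pⁿ)(z)`**, `λ₀(z) = Σ_D Λ₀(z, D)`,
for the scheme `P = t·GSw + (1−t)·(w_E·Ẽ_0 + Π_w^M)`. [ours] -/
theorem dob_lawAt_fst_of (hm : 1 ≤ m) (hμ : ∀ k x, 0 < μ k x)
    {α : Fin m → (Fin (K + 1) → S) → ℝ}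
    (hα : ∀ r z, α r z = min 1 (tensorFun μ (edgeFlowSwap (φ r) 0 (κ r).succ z) / tensorFun μ z))
    {γ : Fin m → (Fin (K + 1) → S) × Finset (Fin (K + 1)) → ℝ}
    {Bset : Fin m → Finset (Fin (K + 1)) → Finset (Fin (K + 1))}
    {Ph : (Fin (K + 1) → S) × Finset (Fin (K + 1)) → (Fin (K + 1) → S) × Finset (Fin (K + 1)) → ℝ}
    (hPh : ∀ a b, Ph a b = ∑ r : Fin m, t / m *
        (γ r a * (if b.1 = edgeFlowSwap (φ r) 0 (κ r).succ a.1 ∧ b.2 = a.2.image (Equiv.swap (0 : Fin (K + 1)) (κ r).succ)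
            then (1 : ℝ) else 0)
          + (α r a.1 - γ r a) * (if b.1 = edgeFlowSwap (φ r) 0 (κ r).succ a.1 ∧ b.2 = Bset r a.2 then (1 : ℝ) else 0)
          + (1 - α r a.1) * (if b.1 = a.1 ∧ b.2 = Bset r a.2 then (1 : ℝ) else 0))
      + (1 - t) * (wE * (coordKernel E 0 a.1 b.1 * (if b.2 = a.2.erase 0 then (1 : ℝ) else 0))
          + ∑ k : Fin (K + 1), w k * (coordKernel M k a.1 b.1 * (if b.2 = a.2 then (1 : ℝ) else 0))))
    (Λ₀ : (Fin (K + 1) → S) × Finset (Fin (K + 1)) → ℝ) (n : ℕ) (z : Fin (K + 1) → S) :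
    ∑ D, lawAt Ph Λ₀ n (z, D) = lawAt (fun y z : Fin (K + 1) → S =>
        t * ptGraphSwap μ (fun r : Fin m => (((0 : Fin (K + 1)), (κ r).succ) : Fin (K + 1) × Fin (K + 1))) φ y z
          + (1 - t) * (wE * coordKernel E 0 y z + prodKernel w M y z)) (fun z => ∑ D, Λ₀ (z, D)) n z := by
  rw [← sum_filter_prodFst_eq (fun b => lawAt Ph Λ₀ n b) z,
    LevinPeres2017_lemma_2_5_lawAt (P := Ph) (proj := Prod.fst)
      (Ps := fun y z : Fin (K + 1) → S =>
        t * ptGraphSwap μ (fun r : Fin m => (((0 : Fin (K + 1)), (κ r).succ) : Fin (K + 1) × Fin (K + 1))) φ y z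
          + (1 - t) * (wE * coordKernel E 0 y z + prodKernel w M y z))
      (fun a z' => dob_lump_fst κ φ hm hμ hα hPh a z')]
  congr 1
  funext z'
  exact sum_filter_prodFst_eq (fun b => Λ₀ b) z'

/-! ## §2 The one-step action on laws, organised by entry and source tag -/

/-- **THE ONE-STEP ACTION OF `P̂` ON A LAW `λ`, BY ENTRY AND SOURCE TAG:** with `y = y_r(z')`,
`(λP̂)(z',D') = Σ_r (t/m)·Σ_D [𝟙{D' = σ_r D}·λ(y,D)γ_r(y,D) + 𝟙{D' = B_r D}·(λ(y,D)(α_r(y) − γ_r(y,D)) + λ(z',D)(1 − α_r(z')))]`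
`+ (1−t)·(w_E·Σ_{D : D ∖ {0} = D'} Σ_u λ(z'[0 ↦ u], D)·E_0(u, z'_0) + Σ_k w_k·Σ_u λ(z'[k ↦ u], D')·M_k(u, z'_k))`. [ours] -/
theorem dob_stepLaw_apply
    {α : Fin m → (Fin (K + 1) → S) → ℝ} {γ : Fin m → (Fin (K + 1) → S) × Finset (Fin (K + 1)) → ℝ}
    {Bset : Fin m → Finset (Fin (K + 1)) → Finset (Fin (K + 1))}
    {Ph : (Fin (K + 1) → S) × Finset (Fin (K + 1)) → (Fin (K + 1) → S) × Finset (Fin (K + 1)) → ℝ}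
    (hPh : ∀ a b, Ph a b = ∑ r : Fin m, t / m *
        (γ r a * (if b.1 = edgeFlowSwap (φ r) 0 (κ r).succ a.1 ∧ b.2 = a.2.image (Equiv.swap (0 : Fin (K + 1)) (κ r).succ)
            then (1 : ℝ) else 0)
          + (α r a.1 - γ r a) * (if b.1 = edgeFlowSwap (φ r) 0 (κ r).succ a.1 ∧ b.2 = Bset r a.2 then (1 : ℝ) else 0)
          + (1 - α r a.1) * (if b.1 = a.1 ∧ b.2 = Bset r a.2 then (1 : ℝ) else 0))
      + (1 - t) * (wE * (coordKernel E 0 a.1 b.1 * (if b.2 = a.2.erase 0 then (1 : ℝ) else 0))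
          + ∑ k : Fin (K + 1), w k * (coordKernel M k a.1 b.1 * (if b.2 = a.2 then (1 : ℝ) else 0))))
    (lam : (Fin (K + 1) → S) × Finset (Fin (K + 1)) → ℝ) (z' : Fin (K + 1) → S) (D' : Finset (Fin (K + 1))) :
    stepLaw Ph lam (z', D')
      = ∑ r : Fin m, t / m * ∑ D : Finset (Fin (K + 1)),
          ((if D' = D.image (Equiv.swap (0 : Fin (K + 1)) (κ r).succ) then (1 : ℝ) else 0)
              * (lam (edgeFlowSwap (φ r) 0 (κ r).succ z', D) * γ r (edgeFlowSwap (φ r) 0 (κ r).succ z', D))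
            + (if D' = Bset r D then (1 : ℝ) else 0)
              * (lam (edgeFlowSwap (φ r) 0 (κ r).succ z', D)
                  * (α r (edgeFlowSwap (φ r) 0 (κ r).succ z') - γ r (edgeFlowSwap (φ r) 0 (κ r).succ z', D))
                + lam (z', D) * (1 - α r z')))
        + (1 - t) * (wE * ∑ D ∈ univ.filter (fun D : Finset (Fin (K + 1)) => D.erase 0 = D'),
              ∑ u : S, lam (update z' 0 u, D) * E 0 u (z' 0)
            + ∑ k : Fin (K + 1), w k * ∑ u : S, lam (update z' k u, D') * M k u (z' k)) := by
  have he := hubList_fst_ne_snd (K := K) κ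
  have hinv := entrySwap_entrySwap κ φ
  -- split every summand `λ(a)·P̂(a, (z',D'))` into its entry part, its refresh part and its move part
  have key : ∀ (z : Fin (K + 1) → S) (D : Finset (Fin (K + 1))), lam (z, D) * Ph (z, D) (z', D')
      = (∑ r : Fin m, t / m * (lam (z, D) *
          (γ r (z, D) * (if z' = edgeFlowSwap (φ r) 0 (κ r).succ z ∧ D' = D.image (Equiv.swap (0 : Fin (K + 1)) (κ r).succ)
              then (1 : ℝ) else 0)
            + (α r z - γ r (z, D)) * (if z' = edgeFlowSwap (φ r) 0 (κ r).succ z ∧ D' = Bset r D then (1 : ℝ) else 0)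
            + (1 - α r z) * (if z' = z ∧ D' = Bset r D then (1 : ℝ) else 0))))
        + ((1 - t) * (wE * (lam (z, D) * (coordKernel E 0 z z' * (if D' = D.erase 0 then (1 : ℝ) else 0))))
          + ∑ k : Fin (K + 1), (1 - t) * (w k * (lam (z, D) * (coordKernel M k z z'
            * (if D' = D then (1 : ℝ) else 0))))) := by
    intro z D
    rw [hPh]
    simp only [mul_add, Finset.mul_sum]
    congr 1
    · exact sum_congr rfl fun r _ => by ring
    · congr 1
      · ring
      · exact sum_congr rfl fun k _ => by ring
  unfold stepLaw
  rw [Fintype.sum_prod_type]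
  simp_rw [key, Finset.sum_add_distrib]
  -- reorder the sums
  rw [Finset.sum_comm (s := (univ : Finset (Fin (K + 1) → S))) (t := (univ : Finset (Finset (Fin (K + 1)))))
      (f := fun z D => ∑ r : Fin m, t / m * (lam (z, D) *
          (γ r (z, D) * (if z' = edgeFlowSwap (φ r) 0 (κ r).succ z ∧ D' = D.image (Equiv.swap (0 : Fin (K + 1)) (κ r).succ)
              then (1 : ℝ) else 0)
            + (α r z - γ r (z, D)) * (if z' = edgeFlowSwap (φ r) 0 (κ r).succ z ∧ D' = Bset r D then (1 : ℝ) else 0)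
            + (1 - α r z) * (if z' = z ∧ D' = Bset r D then (1 : ℝ) else 0)))),
    Finset.sum_comm (s := (univ : Finset (Fin (K + 1) → S))) (t := (univ : Finset (Finset (Fin (K + 1)))))
      (f := fun z D => ∑ k : Fin (K + 1), (1 - t) * (w k * (lam (z, D) * (coordKernel M k z z'
            * (if D' = D then (1 : ℝ) else 0))))),
    Finset.sum_comm (s := (univ : Finset (Fin (K + 1) → S))) (t := (univ : Finset (Finset (Fin (K + 1)))))
      (f := fun z D => (1 - t) * (wE * (lam (z, D) * (coordKernel E 0 z z' * (if D' = D.erase 0 then (1 : ℝ) else 0)))))]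
  simp only [Finset.sum_comm (s := (univ : Finset (Fin (K + 1) → S))) (t := (univ : Finset (Fin m))),
    Finset.sum_comm (s := (univ : Finset (Fin (K + 1) → S))) (t := (univ : Finset (Fin (K + 1))))]
  rw [Finset.sum_comm (s := (univ : Finset (Finset (Fin (K + 1))))) (t := (univ : Finset (Fin m))),
    Finset.sum_comm (s := (univ : Finset (Finset (Fin (K + 1))))) (t := (univ : Finset (Fin (K + 1)))), mul_add]
  congr 1
  · -- entry part: for each `r` and source tag `D`, integrate out `z`
    refine sum_congr rfl fun r _ => ?_
    rw [← Finset.sum_add_distrib, Finset.mul_sum]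
    refine sum_congr rfl fun D _ => ?_
    rw [← Finset.mul_sum]
    congr 1
    have hinvz : ∀ z : Fin (K + 1) → S, z' = edgeFlowSwap (φ r) 0 (κ r).succ z ↔
        z = edgeFlowSwap (φ r) 0 (κ r).succ z' := fun z => eq_edgeFlowSwap_comm _ (he r) z z'
    have h1 : ∀ z : Fin (K + 1) → S, lam (z, D) *
        (γ r (z, D) * (if z' = edgeFlowSwap (φ r) 0 (κ r).succ z ∧ D' = D.image (Equiv.swap (0 : Fin (K + 1)) (κ r).succ)
            then (1 : ℝ) else 0)
          + (α r z - γ r (z, D)) * (if z' = edgeFlowSwap (φ r) 0 (κ r).succ z ∧ D' = Bset r D then (1 : ℝ) else 0)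
          + (1 - α r z) * (if z' = z ∧ D' = Bset r D then (1 : ℝ) else 0))
        = (if z = edgeFlowSwap (φ r) 0 (κ r).succ z' ∧ D' = D.image (Equiv.swap (0 : Fin (K + 1)) (κ r).succ)
              then lam (z, D) * γ r (z, D) else 0)
          + (if z = edgeFlowSwap (φ r) 0 (κ r).succ z' ∧ D' = Bset r D then lam (z, D) * (α r z - γ r (z, D)) else 0)
          + (if z' = z ∧ D' = Bset r D then lam (z, D) * (1 - α r z) else 0) := by
      intro z
      simp only [hinvz z]
      split_ifs <;> ring
    rw [sum_congr rfl (fun z _ => h1 z), Finset.sum_add_distrib, Finset.sum_add_distrib, sum_ite_eqAnd_config,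
      sum_ite_eqAnd_config, sum_ite_eqAnd_config']
    split_ifs <;> ring
  · congr 1
    · -- refresh part: source tags `D` with `D ∖ {0} = D'`, integrate out `z`
      rw [Finset.sum_filter, Finset.mul_sum, Finset.mul_sum]
      refine sum_congr rfl fun D _ => ?_
      by_cases hD : D.erase 0 = D'
      · rw [if_pos hD]
        simp_rw [if_pos hD.symm, mul_one]
        have h := sum_mul_coordKernel_at (M := E) (fun z => lam (z, D)) 0 z'
        calc ∑ z, (1 - t) * (wE * (lam (z, D) * coordKernel E 0 z z'))
            = (1 - t) * (wE * ∑ z, lam (z, D) * coordKernel E 0 z z') := by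
              rw [Finset.mul_sum, Finset.mul_sum]
          _ = (1 - t) * (wE * ∑ u : S, lam (update z' 0 u, D) * E 0 u (z' 0)) := by rw [h]
      · rw [if_neg hD, mul_zero, mul_zero]
        have hD' : ¬ (D' = D.erase 0) := fun h => hD h.symm
        simp_rw [if_neg hD', mul_zero]
        simp
    · -- move part: the source tag is the target tag, integrate out `z`
      rw [Finset.mul_sum]
      refine sum_congr rfl fun k _ => ?_
      rw [Finset.sum_eq_single_of_mem D' (mem_univ _) (fun D _ hDne => by
        have hD' : ¬ (D' = D) := fun h => hDne h.symm
        simp_rw [if_neg hD', mul_zero]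
        simp)]
      simp only [if_true, mul_one]
      have h := sum_mul_coordKernel_at (M := M) (fun z => lam (z, D')) k z'
      calc ∑ z, (1 - t) * (w k * (lam (z, D') * coordKernel M k z z'))
          = (1 - t) * (w k * ∑ z, lam (z, D') * coordKernel M k z z') := by
            rw [Finset.mul_sum, Finset.mul_sum]
        _ = (1 - t) * (w k * ∑ u : S, lam (update z' k u, D') * M k u (z' k)) := by rw [h]

end Aug

end Summit.Ventures.LatticeQCDFlow.Scaling

end
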